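import Mathlib.RingTheory.Regular.RegularSequence
import Mathlib.RingTheory.KrullDimension.Regular
import Mathlib.RingTheory.Ideal.KrullsHeightTheorem
import Literature.RingTheory.TightClosure.TightClosure
import HarnessLib

/-!
# A divisor certificate yields the Fedder–Watanabe data upstairs (crux `FrobeniusLadder.FRationalModification`)

Stub `stub_divisorCertificate` of the skeleton `Sketch` (v7) for crux
stmt-ResolutionOfSingularities-15316 (route `ResolutionOfSingularities/FrobeniusLadder`, rung 3:
F-rational models). Let `(S, 𝔪)` be a Noetherian local domain of prime characteristic `p` and let
`g ∈ 𝔪`, `g ≠ 0`, be a DIVISOR CERTIFICATE: the hypersurface ring `S̄ = S/(g)` is Cohen–Macaulay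
and F-injective, phrased in `S̄`'s own system-of-parameters language — for every `d` with
`dim S̄ = d` and every `t : Fin d → S̄` whose ideal has maximal radical, `t` is a weakly regular
sequence on `S̄` and the ideal `(t)` is Frobenius closed (`ȳ^q ∈ (t)^[q] ⇒ ȳ ∈ (t)`, `q = p^e`).
Then:

* (i) `S` is Cohen–Macaulay in the tree's phrasing: there is an `S`-regular sequence
  (`RingTheory.Sequence.IsRegular S rs`) inside `𝔪` of length `dim S`. Proof: `dim S̄ = d` is
  finite (Noetherian local), `dim S = d + 1` (`g` is a non-zero-divisor in `𝔪`, Mathlib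
  `ringKrullDim_quotient_span_singleton_succ_eq_ringKrullDim`); a system of parameters `t` of `S̄`
  exists (`Literature.RingTheory.TightClosure.exists_isSystemOfParameters`) and is weakly regular
  on `S̄` by the certificate; lifting `t` to `s : Fin d → S` (non-units, as the `t i` lie in a
  proper ideal), the weak regularity transports along `S̄ ≅ S/g•S = QuotSMulTop g S`, so
  `g :: s` is weakly regular on `S` (`IsWeaklyRegular.cons`), hence regular since it lies in `𝔪`
  (Nakayama, `IsRegular.of_isWeaklyRegular_of_mem_maximalIdeal`).
* (ii) with this `d`: for every `s : Fin d → S` with `rad (g, s) = 𝔪` and all `y`, `e`,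
  `y^(p^e) ∈ (g) + (s)^[p^e] ⇒ y ∈ (g, s)`. Proof: modulo `g` the images `s̄` generate an ideal
  with radical `𝔪̄` (image of `rad (g, s) = 𝔪`, `Ideal.map_radical_of_surjective`), i.e. a system
  of parameters of `S̄`; the image of `(s)^[q]` lies in `(s̄)^[q]` (`map_frobeniusPower_le`), so
  `ȳ^q ∈ (s̄)^[q]`, whence `ȳ ∈ (s̄)` by Frobenius closedness, i.e. `y ∈ (s) + (g) = (g, s)`
  (`Ideal.mem_quotient_iff_mem`).

These are exactly the upstairs hypotheses consumed by the landed Fedder–Watanabe chain of the line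
(`stub_sopWeaklyRegular`, `stub_deformFW` = Fedder–Watanabe 1989, Prop. 2.13). Vocabulary:
`Literature.RingTheory.TightClosure` (`frobeniusPower`, `IsSystemOfParameters`) and Mathlib's
`RingTheory.Sequence.IsWeaklyRegular` / `IsRegular`, `QuotSMulTop`. No named facts; no
characteristic-`p` arithmetic is used beyond the shape of the Frobenius powers.

## References

* [FedderWatanabe1989] R. Fedder, K.-i. Watanabe, *A characterization of F-regularity in terms of
  F-purity*, in: Commutative Algebra (MSRI Publ. 15), Springer 1989, 227–245, Prop. 2.13
  (hypotheses: `R/fR` Cohen–Macaulay and F-injective).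
* [Matsumura1987] H. Matsumura, *Commutative Ring Theory*, CUP 1986, Thm. 17.3 (ii), 17.4
  (`A` is CM iff `A/xA` is CM for an `A`-regular `x`; `dim A/xA = dim A - 1`).
-/

-- single-problem summit: the doubled namespace component `ResolutionOfSingularities` is forced
set_option linter.dupNamespace false

namespace Summit.ResolutionOfSingularities.ResolutionOfSingularities.Theorems.FRationalModification.DivisorCertificate

open IsLocalRing RingTheory.Sequence Literature.RingTheory.TightClosure
open scoped Pointwise

section Helpers

variable {R T : Type*} [CommRing R] [CommRing T]

/-- Frobenius powers pushed forward along a ring homomorphism: `f(I^[q]) S ⊆ (f(I) S)^[q]`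
(both sides are generated by `q`-th powers; the left one by those of elements of `I`).
[folklore] -/
theorem map_frobeniusPower_le (f : R →+* T) (q : ℕ) (I : Ideal R) :
    (frobeniusPower q I).map f ≤ frobeniusPower q (I.map f) := by
  rw [frobeniusPower_def, Ideal.map_span, Ideal.span_le]
  rintro _ ⟨_, ⟨x, hx, rfl⟩, rfl⟩
  rw [SetLike.mem_coe, map_pow]
  exact pow_mem_frobeniusPower (Ideal.mem_map_of_mem f hx)

end Helpers

/-- **A divisor certificate yields the Fedder–Watanabe data upstairs** — stub
`stub_divisorCertificate` of crux `FRationalModification`, line `Sketch`. `S` a Noetherian local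
domain of characteristic `p`, `g ∈ 𝔪_S`, `g ≠ 0`, such that the hypersurface ring `S/(g)` is
Cohen–Macaulay and F-injective in its own system-of-parameters language (every s.o.p. `t` of
`S/(g)` — `dim S/(g)` elements generating an ideal with maximal radical — is a weakly regular
sequence generating a Frobenius-closed ideal). Then (i) `S` is Cohen–Macaulay in the tree's
phrasing: there is a regular sequence in `𝔪_S` of length `dim S` (namely `g` followed by lifts of a
weakly regular s.o.p. of `S/(g)`; `dim S/(g) + 1 = dim S`), and (ii) with `dim S = d + 1`: for every
`s : Fin d → S` with `rad (g, s) = 𝔪_S` and every `y`, `e`,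
`y^(p^e) ∈ (g) + (s)^[p^e] ⇒ y ∈ (g, s)` (mod `g`, `s̄` is a s.o.p. of `S/(g)` and `ȳ` lies in the
Frobenius closure of `(s̄)`, which is Frobenius closed).
[cite: FedderWatanabe1989, Prop. 2.13 (hypotheses)] -/
theorem stub_divisorCertificate (p : ℕ) [Fact p.Prime] {S : Type*} [CommRing S] [IsLocalRing S]
    [IsNoetherianRing S] [IsDomain S] [CharP S p] {g : S} (hgm : g ∈ maximalIdeal S) (hg0 : g ≠ 0)
    (hD : ∀ d : ℕ, ringKrullDim (S ⧸ Ideal.span {g}) = d → ∀ t : Fin d → S ⧸ Ideal.span {g},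
      (Ideal.span (Set.range t)).radical.IsMaximal →
        RingTheory.Sequence.IsWeaklyRegular (S ⧸ Ideal.span {g}) (List.ofFn t) ∧
        ∀ y : S ⧸ Ideal.span {g}, (∃ e : ℕ, y ^ p ^ e ∈
          Ideal.span ((fun z : S ⧸ Ideal.span {g} => z ^ p ^ e) ''
            (Ideal.span (Set.range t) : Set (S ⧸ Ideal.span {g})))) →
          y ∈ Ideal.span (Set.range t)) :
    (∃ rs : List S, RingTheory.Sequence.IsRegular S rs ∧ (∀ r ∈ rs, r ∈ maximalIdeal S) ∧
        (rs.length : WithBot ℕ∞) = ringKrullDim S) ∧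
      ∃ d : ℕ, ringKrullDim S = ((d + 1 : ℕ) : WithBot ℕ∞) ∧
        ∀ s : Fin d → S, (Ideal.span (insert g (Set.range s))).radical = maximalIdeal S →
          ∀ (y : S) (e : ℕ), y ^ p ^ e ∈
            Ideal.span {g} ⊔ frobeniusPower (p ^ e) (Ideal.span (Set.range s)) →
            y ∈ Ideal.span (insert g (Set.range s)) := by
  -- (0) the hypersurface ring `S̄ = S/(g)` is a Noetherian local ring and `g` is `S`-regular
  set Sb := S ⧸ Ideal.span {g}
  set mk : S →+* Sb := Ideal.Quotient.mk (Ideal.span {g})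
  have hne : Ideal.span {g} ≠ ⊤ := Ideal.span_singleton_ne_top hgm
  haveI : Nontrivial Sb := Ideal.Quotient.nontrivial_iff.mpr hne
  haveI : IsLocalRing Sb := IsLocalRing.of_surjective' mk Ideal.Quotient.mk_surjective
  have hgreg : IsSMulRegular S g := (_root_.IsRegular.of_ne_zero hg0).left.isSMulRegular
  -- (1) `dim S̄ = d` is finite and `dim S = d + 1`
  obtain ⟨d, hdSb⟩ : ∃ d : ℕ, ringKrullDim Sb = d := by
    obtain ⟨n, hn⟩ := ENat.ne_top_iff_exists.mp
      ((maximalIdeal Sb).height_ne_top (Ideal.IsPrime.ne_top inferInstance))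
    exact ⟨n, by rw [← maximalIdeal_height_eq_ringKrullDim, ← hn]; rfl⟩
  have hdS : ringKrullDim S = ((d + 1 : ℕ) : WithBot ℕ∞) := by
    have h1 := ringKrullDim_quotient_span_singleton_succ_eq_ringKrullDim hgreg hgm
    rw [hdSb] at h1
    rw [← h1, Nat.cast_succ]
  -- the `S`-module `S/g•S = QuotSMulTop g S` is the ring `S̄`
  have hsmul : (g • (⊤ : Submodule S S)) = Ideal.span {g} := by
    rw [← Submodule.ideal_span_singleton_smul, smul_eq_mul, Ideal.mul_top]
  let φ : QuotSMulTop g S ≃ₗ[S] Sb := Submodule.quotEquivOfEq _ _ hsmul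
  -- (2) part (i): lift a (weakly regular) system of parameters `t` of `S̄` to `s : Fin d → S`
  obtain ⟨t, -, htrad⟩ := exists_isSystemOfParameters (R := Sb) hdSb
  have hmax : (Ideal.span (Set.range t)).radical.IsMaximal := by
    rw [htrad]
    exact maximalIdeal.isMaximal Sb
  obtain ⟨hw, -⟩ := hD d hdSb t hmax
  choose s hs using fun i => Ideal.Quotient.mk_surjective (I := Ideal.span {g}) (t i)
  obtain rfl : ⇑mk ∘ s = t := funext hs
  -- the lifts are non-units (the `t i` lie in an ideal with proper radical)
  have hsm : ∀ i, s i ∈ maximalIdeal S := fun i => by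
    rw [mem_maximalIdeal, mem_nonunits_iff]
    intro hu
    exact hmax.ne_top
      (Ideal.eq_top_of_isUnit_mem _ (Ideal.le_radical (Ideal.subset_span ⟨i, rfl⟩)) (hu.map mk))
  -- weak regularity of `s` on the `S`-module `S̄`, then on `QuotSMulTop g S`, then `g :: s` on `S`
  have hw₁ : RingTheory.Sequence.IsWeaklyRegular Sb (List.ofFn s) := by
    have h := (isWeaklyRegular_map_algebraMap_iff Sb Sb (List.ofFn s)).mp
    rw [Ideal.Quotient.algebraMap_eq, List.map_ofFn] at h
    exact h hw
  have hw₂ : RingTheory.Sequence.IsWeaklyRegular (QuotSMulTop g S) (List.ofFn s) :=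
    (φ.isWeaklyRegular_congr _).mpr hw₁
  have hwreg : RingTheory.Sequence.IsWeaklyRegular S (g :: List.ofFn s) :=
    IsWeaklyRegular.cons hgreg hw₂
  have hmem : ∀ r ∈ g :: List.ofFn s, r ∈ maximalIdeal S :=
    List.forall_mem_cons.mpr ⟨hgm, List.forall_mem_ofFn_iff.mpr hsm⟩
  have hreg : RingTheory.Sequence.IsRegular S (g :: List.ofFn s) :=
    RingTheory.Sequence.IsRegular.of_isWeaklyRegular_of_mem_maximalIdeal S hmem hwreg
  refine ⟨⟨g :: List.ofFn s, hreg, hmem, ?_⟩, d, hdS, ?_⟩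
  · rw [List.length_cons, List.length_ofFn, hdS]
  -- (3) part (ii): F-injectivity of `S̄` at the image system of parameters, read upstairs
  intro u hu y e hy
  have hJ : Ideal.span {g} ≤ Ideal.span (insert g (Set.range u)) :=
    (Ideal.span_singleton_le_iff_mem _).mpr (Ideal.subset_span (Set.mem_insert _ _))
  have hg0' : mk g = 0 := Ideal.Quotient.eq_zero_iff_mem.mpr (Ideal.mem_span_singleton_self g)
  have hmapu : Ideal.map mk (Ideal.span (Set.range u)) = Ideal.span (Set.range (⇑mk ∘ u)) := by
    rw [Ideal.map_span, ← Set.range_comp]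
  have hmap : Ideal.map mk (Ideal.span (insert g (Set.range u))) =
      Ideal.span (Set.range (⇑mk ∘ u)) := by
    rw [Ideal.map_span, Set.image_insert_eq, hg0', Ideal.span_insert_zero, ← Set.range_comp]
  -- `ū` is a system of parameters of `S̄`: `rad (ū) = image of rad (g, u) = 𝔪̄`
  have hrad : (Ideal.span (Set.range (⇑mk ∘ u))).radical.IsMaximal := by
    have hker : RingHom.ker mk ≤ Ideal.span (insert g (Set.range u)) := by
      rw [Ideal.mk_ker]
      exact hJ
    rw [← hmap, ← Ideal.map_radical_of_surjective Ideal.Quotient.mk_surjective hker, hu,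
      map_maximalIdeal_of_surjective mk Ideal.Quotient.mk_surjective]
    exact maximalIdeal.isMaximal Sb
  obtain ⟨-, hF⟩ := hD d hdSb (⇑mk ∘ u) hrad
  -- `ȳ^q ∈ (ū)^[q]`, hence `ȳ ∈ (ū)` by Frobenius closedness
  have hy' : mk y ∈ Ideal.span (Set.range (⇑mk ∘ u)) := by
    refine hF (mk y) ⟨e, ?_⟩
    change mk y ^ p ^ e ∈ frobeniusPower (p ^ e) (Ideal.span (Set.range (⇑mk ∘ u)))
    rw [← map_pow mk y (p ^ e), ← hmapu]
    obtain ⟨a, ha, b, hb, hab⟩ := Submodule.mem_sup.mp hy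
    rw [← hab, map_add, Ideal.Quotient.eq_zero_iff_mem.mpr ha, zero_add]
    exact map_frobeniusPower_le mk (p ^ e) _ (Ideal.mem_map_of_mem mk hb)
  -- read upstairs: `y ∈ (g, u)`
  rw [← hmap, Ideal.mem_quotient_iff_mem hJ] at hy'
  exact hy'

end Summit.ResolutionOfSingularities.ResolutionOfSingularities.Theorems.FRationalModification.DivisorCertificate
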